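import Literature.AnabelianGeometry.EtaleTheta.LogDivisorTower
import Literature.AnabelianGeometry.EtaleTheta.LogDivisorModelTateTower

/-!
# [EtTh] Def. 3.3 (i)(c)/(ii)/(iii) v2 («covering-indexed Mero»): the KUMMER TOWER over the Tate skeleton — a
# multi-level inhabitant of `LevelSystem` / `LogDivisorTower` in which roots of `U` appear at deeper levels

S. Mochizuki, *The étale theta function …*, Publ. RIMS **45** (2009) [MochizukiEtTh2009], §3 Def. 3.1 / Prop. 3.2 (PDF
p.70), Def. 3.3 (i)(c) p.72, (ii) p.73 (`Δ^fil`-coverings `Z^log_∞ → X^log`, `Δ^fil`-closures), (iii) pp.73–74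
(«the inductive limits range over the `Δ^fil`-closures `Z^log_∞ → Y^log` of `Y^log → X^log`»); §1 p.12 (the universal
combinatorial covering of a Tate curve; Kummer coverings adjoining roots of the coordinate `U` and of `q`)
[cite: MochizukiEtTh2009, Def 3.3 (iii) p.73].

CLASS (b) MODEL (abc-iut cell, W6 seat d058 lineage, gen 3; abc-iut-plan C-R34 / L2-lead R520 «Tate tower v2 NV —
GO on landing of part B»; abc-iut-L2-t3's v2 interface `LevelSystem` (p455241) / `LogDivisorTower` (p455437) /
`DivisorMonoids.ofTower` and this lineage's skeleton `LogDivisorModel.TateTower` (p444705) consumed BY NAME).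
* `LogDivisorModel.GaloisAction.comap` — restriction of a Galois action along a group homomorphism (plumbing).
* The group `TateTowerKummer.Grp := ℤ_γ × ℤ^ℕ` — translations of the chain × a Kummer part with the PRODUCT topology
  (`ℤ` discrete): the subgroups `Δ_n := {γ-trivial, first n Kummer coordinates trivial}` (`TateTowerKummer.closure n`)
  are open, nested (`closure_antitone`), and every open stabiliser contains one (`exists_closure_subset_of_isOpen`,
  Mathlib `isOpen_pi_iff`) — so every connected tempered `Grp`-set `Y` has a LEVEL
  **`lvl Y := sInf {n | Δ_n fixes Y}`**, monotone along covering maps (`lvl_le_of_hom`):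
  **`TateTowerKummer.levels : LevelSystem Grp`**, both laws PROVED.
* **`TateTowerKummer.tower : LogDivisorTower Grp levels`** — level `n` = the Kummer stage `Z_∞^{(n)}` over which
  `ϖ^{1/n!}` and `U^{1/n!}` exist, with the SAME combinatorial skeleton `TateTower.model` (chain `ℤ` of components,
  `Fn = ⟨ϖ_n⟩ × ⟨U_n⟩`, Prop. 3.2 (ii)/(iii) with content — p444705), `Grp` acting through `γ` (translation; the Kummer
  part acts TRIVIALLY on the skeleton — no roots of unity are recorded: HONEST LABEL), `Δ_n` trivial at level `n`, and
  the transition `Z_∞^{(m)} → Z_∞^{(n)}` (`n ≤ m`) = RAISING TO THE RAMIFICATION INDEX `e = m!/n!` on functions and on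
  log-divisors (`ϖ_n = ϖ_m^{e}`, `U_n = U_m^{e}`, a prime divisor of `Z_∞^{(n)}` pulls back with multiplicity `e`);
  all tower laws are `map_pow`/`pow_mem` facts (`TateTowerKummer.e`, `e_mul_e`).
The ROOT LAW `(DivisorMonoids.ofTower tower).RootLaw` (E2 (a)) and the non-degeneracy of `B₀` at every level are the
sequel `LogDivisorModelTateTowerKummerRootLaw.lean`.  HONEST FRAMING: a combinatorial consistency witness for the v2
interface (NOT the formal-scheme tower of a Tate curve); nothing here bears on [IUTchIII] Cor. 3.12; no side taken;
typed ≠ proved.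
-/

noncomputable section

namespace Literature.AnabelianGeometry.EtaleTheta

open CategoryTheory Opposite Function Literature.AlgebraicGeometry.Frobenioids
  Literature.AlgebraicGeometry.Frobenioids.QuasiTemperoid Literature.AnabelianGeometry.SemiGraphs

/-! ## Plumbing: restricting a Galois action along a homomorphism -/

namespace LogDivisorModel.GaloisAction

universe u

/-- Restriction of a Galois action on the Def. 3.1 interface along a group homomorphism `φ : H → G` (every law pulls
back). [cite: MochizukiEtTh2009, Def 3.3 p.73] -/
def comap {Z : LogDivisorModel.{u}} {G H : Type u} [Group G] [Group H] (A : Z.GaloisAction G) (φ : H →* G) :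
    Z.GaloisAction H where
  actFn := A.actFn.comp φ
  actDIV := A.actDIV.comp φ
  permCusp := A.permCusp.comp φ
  permComp := A.permComp.comp φ
  act_mem_DIVplus g _ hd := A.act_mem_DIVplus (φ g) hd
  act_mem_Div g _ hd := A.act_mem_Div (φ g) hd
  act_mem_logMero g _ hf := A.act_mem_logMero (φ g) hf
  act_mem_const g _ hf := A.act_mem_const (φ g) hf
  act_mem_intConst g _ hf := A.act_mem_intConst (φ g) hf
  divisor_act g f := A.divisor_act (φ g) f
  mult_act g d x := A.mult_act (φ g) d x

/-- `comap` on functions. [cite: MochizukiEtTh2009, Def 3.3 p.73] -/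
@[simp] theorem comap_actFn {Z : LogDivisorModel.{u}} {G H : Type u} [Group G] [Group H] (A : Z.GaloisAction G)
    (φ : H →* G) (g : H) : (A.comap φ).actFn g = A.actFn (φ g) := rfl

/-- `comap` on log-divisors. [cite: MochizukiEtTh2009, Def 3.3 p.73] -/
@[simp] theorem comap_actDIV {Z : LogDivisorModel.{u}} {G H : Type u} [Group G] [Group H] (A : Z.GaloisAction G)
    (φ : H →* G) (g : H) : (A.comap φ).actDIV g = A.actDIV (φ g) := rfl

end LogDivisorModel.GaloisAction

/-! ## The group `ℤ_γ × ℤ^ℕ` and its level subgroups `Δ_n` -/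

namespace TateTowerKummer

/-- **The Galois group of the Kummer–Tate tower**: translations of the chain (`ℤ_γ`, discrete) × a Kummer part `ℤ^ℕ`
(product topology) — a topological group whose open subgroups all contain some `Δ_n`.
[cite: MochizukiEtTh2009, Def 3.3 (ii) p.73] -/
abbrev Grp : Type := Multiplicative ℤ × (ℕ → Multiplicative ℤ)

/-- **`Δ_n = Δ^{fil,∞}_n`**: trivial translation and trivial first `n` Kummer coordinates (the subgroup of
`π₁(Z_∞^{(n)})`-type at level `n`). [cite: MochizukiEtTh2009, Def 3.3 (i) p.72] -/
def closure (n : ℕ) : Subgroup Grp where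
  carrier := {g | g.1 = 1 ∧ ∀ i < n, g.2 i = 1}
  mul_mem' := by
    rintro a b ⟨ha, ha'⟩ ⟨hb, hb'⟩
    exact ⟨by rw [Prod.fst_mul, ha, hb, mul_one], fun i hi => by rw [Prod.snd_mul, Pi.mul_apply, ha' i hi, hb' i hi, mul_one]⟩
  one_mem' := ⟨rfl, fun _ _ => rfl⟩
  inv_mem' := by
    rintro a ⟨ha, ha'⟩
    exact ⟨by rw [Prod.fst_inv, ha, inv_one], fun i hi => by rw [Prod.snd_inv, Pi.inv_apply, ha' i hi, inv_one]⟩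

/-- Membership in `Δ_n`. [cite: MochizukiEtTh2009, Def 3.3 (i) p.72] -/
theorem mem_closure_iff (n : ℕ) (g : Grp) : g ∈ closure n ↔ g.1 = 1 ∧ ∀ i < n, g.2 i = 1 := Iff.rfl

/-- The `Δ_n` are nested: `Δ_m ⊆ Δ_n` for `n ≤ m`. [cite: MochizukiEtTh2009, Def 3.3 (i) p.72] -/
theorem closure_antitone {n m : ℕ} (h : n ≤ m) : closure m ≤ closure n :=
  fun _ hg => ⟨hg.1, fun i hi => hg.2 i (lt_of_lt_of_le hi h)⟩

/-- The Kummer generator in coordinate `i`. [cite: MochizukiEtTh2009, Def 3.3 (ii) p.73] -/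
def delta (i : ℕ) : Grp := (1, Pi.mulSingle i (Multiplicative.ofAdd 1))

/-- `δ_i ∈ Δ_n` iff `n ≤ i`. [cite: MochizukiEtTh2009, Def 3.3 (i) p.72] -/
theorem delta_mem_closure_iff (i n : ℕ) : delta i ∈ closure n ↔ n ≤ i := by
  rw [mem_closure_iff]
  constructor
  · rintro ⟨-, h⟩
    by_contra hlt
    have h1 := h i (lt_of_not_ge hlt)
    change Pi.mulSingle (M := fun _ : ℕ => Multiplicative ℤ) i (Multiplicative.ofAdd (1 : ℤ)) i = 1 at h1
    rw [Pi.mulSingle_eq_same] at h1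
    exact one_ne_zero (Multiplicative.ofAdd.injective h1)
  · intro h
    refine ⟨rfl, fun j hj => ?_⟩
    change Pi.mulSingle (M := fun _ : ℕ => Multiplicative ℤ) i (Multiplicative.ofAdd (1 : ℤ)) j = 1
    rw [Pi.mulSingle_eq_of_ne (Nat.ne_of_lt (lt_of_lt_of_le hj h))]

/-- `Δ_j ⊆ Δ_i` forces `i ≤ j` (the levels are linearly ordered by their closures). [cite: MochizukiEtTh2009, Def 3.3 (i) p.72] -/
theorem le_of_closure_le {i j : ℕ} (h : closure j ≤ closure i) : i ≤ j :=
  (delta_mem_closure_iff j i).1 (h ((delta_mem_closure_iff j j).2 le_rfl))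

/-- **Every open neighbourhood of `1` in `Grp` contains some `Δ_n`** (product topology: finitely many Kummer coordinates
are constrained; the translation factor is discrete). [cite: MochizukiEtTh2009, Def 3.3 (i) p.72] -/
theorem exists_closure_subset_of_isOpen {U : Set Grp} (hU : IsOpen U) (h1 : (1 : Grp) ∈ U) :
    ∃ n, (closure n : Set Grp) ⊆ U := by
  obtain ⟨u, v, hu, hv, h1u, h1v, huv⟩ := isOpen_prod_iff.1 hU 1 1 h1
  obtain ⟨I, w, hw, hIw⟩ := isOpen_pi_iff.1 hv 1 h1v
  refine ⟨I.sup id + 1, fun g hg => huv ⟨?_, hIw ?_⟩⟩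
  · rw [hg.1]; exact h1u
  · intro a ha
    have hlt : a < I.sup id + 1 := Nat.lt_succ_of_le (Finset.le_sup (f := id) ha)
    rw [hg.2 a hlt]
    exact (hw a ha).2

/-! ## The level of a connected tempered covering -/

/-- A point of a tempered `Grp`-set is fixed by some `Δ_n` (its stabiliser is open). [cite: MochizukiEtTh2009, Def 3.3 (ii) p.73] -/
theorem exists_closure_fix (T : BTemp Grp) (y : T.obj.V) : ∃ n, ∀ g ∈ closure n, T.obj.ρ g y = y := by
  obtain ⟨n, hn⟩ := exists_closure_subset_of_isOpen (T.property.2 y) (BTempConnected.ρ_one_apply T y)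
  exact ⟨n, fun g hg => hn hg⟩

/-- For a CONNECTED tempered covering one `Δ_n` fixes every point (`Grp` is commutative: all stabilisers coincide).
[cite: MochizukiEtTh2009, Def 3.3 (ii) p.73] -/
theorem exists_closure_fixes (Y : ConnectedPart (BTemp Grp)) :
    ∃ n, ∀ g ∈ closure n, ∀ y : Y.obj.obj.V, Y.obj.obj.ρ g y = y := by
  obtain ⟨y₀⟩ := BTempConnected.nonempty_of_isConnectedObj Y.obj Y.property
  obtain ⟨n, hn⟩ := exists_closure_fix Y.obj y₀
  refine ⟨n, fun g hg y => ?_⟩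
  obtain ⟨h, rfl⟩ := BTempConnected.exists_ρ_eq_of_isConnectedObj Y.obj Y.property y₀ y
  rw [← BTempConnected.ρ_mul_apply, mul_comm, BTempConnected.ρ_mul_apply, hn g hg]

/-- **The level of a connected tempered covering `Y`**: the least `n` such that `Δ_n` fixes `Y` (the index of its
`Δ^fil`-closure). [cite: MochizukiEtTh2009, Def 3.3 (ii) p.73] -/
def lvl (Y : ConnectedPart (BTemp Grp)) : ℕ := sInf {n | ∀ g ∈ closure n, ∀ y : Y.obj.obj.V, Y.obj.obj.ρ g y = y}

/-- `Δ_{lvl Y}` fixes `Y`. [cite: MochizukiEtTh2009, Def 3.3 (i) p.72] -/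
theorem closure_lvl_fixes (Y : ConnectedPart (BTemp Grp)) :
    ∀ g ∈ closure (lvl Y), ∀ y : Y.obj.obj.V, Y.obj.obj.ρ g y = y :=
  Nat.sInf_mem (s := {n | ∀ g ∈ closure n, ∀ y : Y.obj.obj.V, Y.obj.obj.ρ g y = y}) (exists_closure_fixes Y)

/-- Minimality of the level: if `Δ_n` fixes `Y` then `lvl Y ≤ n`. [cite: MochizukiEtTh2009, Def 3.3 (i) p.72] -/
theorem lvl_le {Y : ConnectedPart (BTemp Grp)} {n : ℕ} (h : ∀ g ∈ closure n, ∀ y : Y.obj.obj.V, Y.obj.obj.ρ g y = y) :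
    lvl Y ≤ n :=
  Nat.sInf_le h

/-- **Levels are monotone along covering maps**: `Y' → Y` ⇒ `lvl Y ≤ lvl Y'` (covering maps of connected coverings are
surjective and equivariant). [cite: MochizukiEtTh2009, Def 3.3 (i) p.72] -/
theorem lvl_le_of_hom {Y Y' : ConnectedPart (BTemp Grp)} (f : Y' ⟶ Y) : lvl Y ≤ lvl Y' := by
  obtain ⟨y'₀⟩ := BTempConnected.nonempty_of_isConnectedObj Y'.obj Y'.property
  refine lvl_le fun g hg y => ?_
  obtain ⟨y', rfl⟩ := BTempConnected.surjective_of_isConnectedObj y'₀ Y.property f.hom y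
  rw [← BTempConnected.hom_ρ, closure_lvl_fixes Y' g hg y']

/-- **The level structure of the Kummer–Tate tower** (Def. 3.3 (i)(c)/(ii) for the group `ℤ_γ × ℤ^ℕ`): levels `ℕ`,
`Δ_n`, `lvl`; both laws PROVED. [cite: MochizukiEtTh2009, Def 3.3 (i) p.72] -/
def levels : LevelSystem Grp where
  I := ℕ
  closure := closure
  closure_normal _ := inferInstance
  lvl := lvl
  closure_lvl_act Y g hg y := closure_lvl_fixes Y g hg y
  closure_lvl_mono f := closure_antitone (lvl_le_of_hom f)

/-! ## The tower: every level is the Tate skeleton, transitions raise to the ramification index -/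

/-- The ramification index of `Z_∞^{(j)} → Z_∞^{(i)}`: `e i j = j!/i!`. [cite: MochizukiEtTh2009, Def 3.3 (ii) p.73] -/
def e (i j : ℕ) : ℕ := j.factorial / i.factorial

/-- `i! · e i j = j!` for `i ≤ j`. [cite: MochizukiEtTh2009, Def 3.3 (ii) p.73] -/
theorem factorial_mul_e {i j : ℕ} (h : i ≤ j) : i.factorial * e i j = j.factorial :=
  Nat.mul_div_cancel' (Nat.factorial_dvd_factorial h)

/-- `e i i = 1`. [cite: MochizukiEtTh2009, Def 3.3 (ii) p.73] -/
theorem e_self (i : ℕ) : e i i = 1 := Nat.div_self (Nat.factorial_pos i)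

/-- `e` is multiplicative along `i ≤ j ≤ k`. [cite: MochizukiEtTh2009, Def 3.3 (ii) p.73] -/
theorem e_mul_e {i j k : ℕ} (hij : i ≤ j) (hjk : j ≤ k) : e i j * e j k = e i k := by
  have hi : 0 < i.factorial := Nat.factorial_pos i
  refine Nat.eq_of_mul_eq_mul_left hi ?_
  rw [← mul_assoc, factorial_mul_e hij, factorial_mul_e hjk, factorial_mul_e (hij.trans hjk)]

/-- `e i j ≥ 1` for `i ≤ j`. [cite: MochizukiEtTh2009, Def 3.3 (ii) p.73] -/
theorem e_pos {i j : ℕ} (h : i ≤ j) : 0 < e i j :=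
  Nat.div_pos (Nat.factorial_le h) (Nat.factorial_pos i)

/-- Raising to a positive power is injective on the functions `Fn = ⟨ϖ⟩ × ⟨U⟩ ≅ ℤ²` of the skeleton.
[cite: MochizukiEtTh2009, Prop 3.2 p.70] -/
theorem pow_injective_fn {m : ℕ} (hm : 0 < m) : Injective fun f : Multiplicative (ℤ × ℤ) => f ^ m := by
  intro a b hab
  have h : m • Multiplicative.toAdd a = m • Multiplicative.toAdd b := by
    rw [← toAdd_pow, ← toAdd_pow]
    exact congrArg Multiplicative.toAdd hab
  have hm' : (m : ℤ) ≠ 0 := by exact_mod_cast hm.ne'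
  refine Multiplicative.toAdd.injective (Prod.ext ?_ ?_)
  · have h1 := congrArg Prod.fst h
    rw [Prod.smul_fst, Prod.smul_fst, nsmul_eq_mul, nsmul_eq_mul] at h1
    exact mul_left_cancel₀ hm' h1
  · have h2 := congrArg Prod.snd h
    rw [Prod.smul_snd, Prod.smul_snd, nsmul_eq_mul, nsmul_eq_mul] at h2
    exact mul_left_cancel₀ hm' h2

/-- The action of `Grp` at every level: through the translation factor `γ` (the skeleton's `TateTower.action`); the
Kummer part acts trivially on the skeleton. [cite: MochizukiEtTh2009, Def 3.3 (iii) p.73] -/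
def act : LogDivisorModel.TateTower.model.GaloisAction Grp :=
  LogDivisorModel.TateTower.action.comap (MonoidHom.fst _ _)

/-- **The Kummer–Tate tower** (every field of the v2 interface a definition or a theorem): level `n` = the skeleton
`TateTower.model` read as `Z_∞^{(n)}` (`Fn = ⟨ϖ^{1/n!}⟩ × ⟨U^{1/n!}⟩`), `Grp` acting through `γ`, `Δ_n` trivial, and
the transitions `Z_∞^{(m)} → Z_∞^{(n)}` raising functions and log-divisors to the ramification index `m!/n!`.
[cite: MochizukiEtTh2009, Def 3.3 (iii) p.73] -/
def tower : LogDivisorTower Grp levels where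
  Z _ := LogDivisorModel.TateTower.model
  cuspLaws _ := LogDivisorModel.TateTower.cuspLaws
  act _ := act
  act_closure_fn _ g hg := by
    change LogDivisorModel.TateTower.action.actFn g.1 = 1
    rw [hg.1, map_one]
  act_closure_div _ g hg := by
    change LogDivisorModel.TateTower.action.actDIV g.1 = 1
    rw [hg.1, map_one]
  resFn {i j} _ := powMonoidHom (e i j)
  resDIV {i j} _ := powMonoidHom (e i j)
  resFn_refl i f := by
    change f ^ e i i = f
    rw [e_self, pow_one]
  resFn_trans {i j k} hij hjk f := by
    change f ^ e i k = (f ^ e i j) ^ e j k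
    rw [← pow_mul, e_mul_e (le_of_closure_le hij) (le_of_closure_le hjk)]
  resDIV_refl i d := by
    change d ^ e i i = d
    rw [e_self, pow_one]
  resDIV_trans {i j k} hij hjk d := by
    change d ^ e i k = (d ^ e i j) ^ e j k
    rw [← pow_mul, e_mul_e (le_of_closure_le hij) (le_of_closure_le hjk)]
  resFn_injective {i j} h := pow_injective_fn (e_pos (le_of_closure_le h))
  resFn_mem_logMero _ _ _ := trivial
  resFn_mem_const {i j} _ f hf := Subgroup.pow_mem _ hf (e i j)
  resFn_mem_intConst {i j} _ f hf := Submonoid.pow_mem _ hf (e i j)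
  resDIV_mem_DIVplus {i j} _ d hd := Submonoid.pow_mem _ hd (e i j)
  resDIV_mem_Div _ _ _ := trivial
  resDIV_mem_nonCuspidal _ _ _ := trivial
  resDIV_mem_cuspidal {i j} _ d hd := Subgroup.pow_mem _ hd (e i j)
  divisor_resFn {i j} _ f := map_pow LogDivisorModel.TateTower.model.divisor f (e i j)
  resFn_act {i j} _ g f := (map_pow (act.actFn g) f (e i j)).symm
  resDIV_act {i j} _ g d := (map_pow (act.actDIV g) d (e i j)).symm

/-- The level-`n` datum of the tower IS the skeleton. [cite: MochizukiEtTh2009, Def 3.3 (iii) p.73] -/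
theorem tower_Z (n : ℕ) : tower.Z n = LogDivisorModel.TateTower.model := rfl

/-- The action at every level is `act` (through `γ`). [cite: MochizukiEtTh2009, Def 3.3 (iii) p.73] -/
theorem tower_act (n : ℕ) : tower.act n = act := rfl

/-- The transition on functions is `x ↦ x^{e}`. [cite: MochizukiEtTh2009, Def 3.3 (iii) p.73] -/
theorem tower_resFn_apply {i j : ℕ} (h : levels.closure j ≤ levels.closure i) (f : LogDivisorModel.TateTower.model.Fn) :
    tower.resFn h f = f ^ e i j := rfl

/-- The v2 interface has a MULTI-LEVEL inhabitant. [cite: MochizukiEtTh2009, Def 3.3 (iii) p.73] -/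
theorem nonempty_tower : Nonempty (LogDivisorTower Grp levels) := ⟨tower⟩

end TateTowerKummer

end Literature.AnabelianGeometry.EtaleTheta

end
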